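import Summits.QuantumFields.BalabanUV.T4Continuum.Support.SubspacePairPerturbation
import Summits.QuantumFields.BalabanUV.T4Continuum.Support.RegularLaplacianRelativeBound
import Summits.QuantumFields.BalabanUV.T4Continuum.Support.VariationalVectorGaugeSliceFlat

/-!
# T⁴ programme, spine node NE2 (U1a), lane P2 — toward (GF3) WITH BACKGROUND, file 3: IN A REGULAR SMALL GAUGE THE SLICE SUBSPACE `S_R(ker Q′_1) = div_R D_R(ker Q′_1)`
# OF BAŁABAN's PROJECTED GAUGE FUNCTIONAL IS `ε`-CLOSE TO THE FLAT ONE `Δ(ker Q′_1)`, `ε = regEps d n a ℓ = √(24d(na)² + 48d²(n²a² + n²ℓ)²)` — UNIFORMLY IN `n`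
# in the class `na ≤ α`, `n²ℓ ≤ λ`; consequences: two-sided comparison of the projected divergences `‖Π_{S_1} v‖`, `‖Π_{S_R} v‖`, `‖v − Π_{S_R} v‖` for every `v`
# (model level, general finite-dimensional Hilbert `E`, flat site transports)

NE2 formalisation swarm `b2b-balaban-t4-ne2-formalise-*`, leaf prover 03 GEN 6 (`prover-b2b-balaban-t4-ne2-formalise-leaf-03-g6-0`); journal INTENT
CLAIMS.log l.18308 «(GF3) WITH BACKGROUND IN THE REGULAR GAUGE — STEP 1».  On top of files 1–2 of this item (`SubspacePairPerturbation.{oneSided_of_relBound,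
relBound_symm, norm_starProjection_le_of_oneSided, norm_sub_starProjection_le_of_oneSided}`, `RegularLaplacianRelativeBound.relBound_of_regular`) and
leaf-09-g7's `VariationalVectorGaugeSlice.{lapOp, sliceSub}` ∕ `VariationalVectorGaugeSliceFlat.kerAvgFlat` — BY NAME.

THE STATEMENTS ([folklore]).  Unitary `R` with `‖R − 1‖ ≤ a` and longitudinal lattice-Lipschitz constant `‖R(x,μ) − R(x−e_μ,μ)‖ ≤ ℓ` (the regular class;
Bałaban's (3.35)–(3.36) in lattice units, this lineage's `RegularBackgroundTower` shape), `K = ker Q′_1` (flat site transports), `S_R = sliceSub R K`, `S_1 = sliceSub 1 K`: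
 * `sliceSub_eq_map` (`S_R = K.map (toLp ∘ lapOp R)`), `norm_toLp_eq_sqrt` (`‖toLp f‖ = √(nsqv f)`);
 * **`oneSided_flat`**: every `y ∈ S_1` has `‖y − Π_{S_R} y‖ ≤ ε·‖y‖`; **`oneSided_reg`** (`ε < 1`): every `y′ ∈ S_R` has `‖y′ − Π_{S_1} y′‖ ≤ (ε/(1−ε))·‖y′‖`;
 * **`norm_proj_flat_le`**: `(1 − ε)·‖Π_{S_1} v‖ ≤ ‖Π_{S_R} v‖ + (ε/(1−ε))·‖v‖`; **`norm_orth_reg_le`**: `‖v − Π_{S_R} v‖ ≤ ‖v − Π_{S_1} v‖ + ε·‖Π_{S_1} v‖` — every `v`.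
These are the two inputs through which the flat coercivity (1.90) (`VariationalVectorGaugeSliceB5.garding_flat`) transfers to the background in the (GF3)
assembly (file 4 of the item, recipe in `t4/T4-EST-NE2-P2-REG.md` v1.1 §4).  NUMERICS (kit j102549): measured `‖Π_{S_R} − Π_{S_1}‖ = 0.0143 ∕ 0.043 ∕ 0.141` at
`c ≈ 0.1 ∕ 0.3 ∕ 1` («sin» backgrounds, d = 2), n-independent — `regEps` is a (loose) kernel majorant of the same order structure.

HONEST FRAMING (T4-DAG p. 1).  Rung (B)+1 only — NOT infinite volume, NOT a mass gap, NOT Clay.  NE2 NOT IN PRINT, NOT proved here.  MODEL LEVEL: `R` DATA in a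
regular gauge, FLAT site transports (`K = ker Q′_1`; the covariant taxi-`T′` version is NOT covered — its relative bound grows like `n^{3/2}`, memo §4, though its
measured gap is n-uniform too); c5.  OURS, [folklore]; one data `def` (`regEps`); no `def … : Prop`; no `sorry`; axioms standard.  (GF3) with background NOT proved
in this file; V-END ∕ NE2 NOT proved; NE3 OPEN; spine PROVED 0∕9.  HONEST DEPENDENCY (cell, verbatim): continuum YM on T⁴ ⇐ BetaPertH ∧ nine spine estimates
(0/9 proved); BetaPertH ⇐ (D1) ∧ (D4) ∧ CAP+tail; G-an2-4 gates asym, D1 and NE2/3/4.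
-/

noncomputable section

namespace Summit.QuantumFields.BalabanUV.T4Continuum.SliceSubspaceRegular

open Finset WithLp
open scoped InnerProductSpace ComplexConjugate BigOperators
open Literature.MathematicalPhysics.QuantumFieldTheory.Balaban1983to89.B5Prop11Plancherel (Tor fine unitVec)
open Summit.QuantumFields.BalabanUV.T4Continuum.VariationalColourFederbush (Qcv)
open Summit.QuantumFields.BalabanUV.T4Continuum.VariationalColourBochner (negLapv nsqv nsqv_nonneg)
open Summit.QuantumFields.BalabanUV.T4Continuum.VariationalVectorGaugeSlice (avgOp avgOp_apply lapOp lapOp_eq_negLapv sliceSub norm_toLp_sq)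
open Summit.QuantumFields.BalabanUV.T4Continuum.VariationalVectorGaugeSliceFlat (kerAvgFlat)
open Summit.QuantumFields.BalabanUV.T4Continuum.SubspacePairPerturbation
open Summit.QuantumFields.BalabanUV.T4Continuum.RegularLaplacianRelativeBound (relBound_of_regular)

variable {d : ℕ}
variable {E : Type*} [NormedAddCommGroup E] [InnerProductSpace ℂ E] [CompleteSpace E]

/-! ## §1 The slice subspace as an image; the `ℓ²` norm of a field -/

section Image

variable (N : Fin d → ℕ) [∀ μ, NeZero (N μ)]

omit [∀ μ, NeZero (N μ)] in
/-- the `toLp`-composed operator `k ↦ toLp (div_R D_R k)`. [folklore] -/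
theorem lapLp_apply (R : Tor N → Fin d → (E →L[ℂ] E)) (k : Tor N → E) :
    ((WithLp.linearEquiv 2 ℂ (Tor N → E)).symm.toLinearMap ∘ₗ lapOp N R) k = toLp 2 (lapOp N R k) := rfl

omit [∀ μ, NeZero (N μ)] in
/-- **the slice subspace is the image of `K` under `toLp ∘ (div_R D_R)`**. [folklore] -/
theorem sliceSub_eq_map (R : Tor N → Fin d → (E →L[ℂ] E)) (K : Submodule ℂ (Tor N → E)) :
    sliceSub N R K = K.map ((WithLp.linearEquiv 2 ℂ (Tor N → E)).symm.toLinearMap ∘ₗ lapOp N R) := by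
  rw [Submodule.map_comp]
  unfold sliceSub
  exact Submodule.comap_equiv_eq_map_symm _ _

omit [InnerProductSpace ℂ E] [CompleteSpace E] in
/-- `‖toLp f‖ = √(nsqv f)`. [folklore] -/
theorem norm_toLp_eq_sqrt (f : Tor N → E) : ‖toLp 2 f‖ = Real.sqrt (nsqv N f) := by
  rw [← Real.sqrt_sq (norm_nonneg (toLp 2 f)), norm_toLp_sq]
  rfl

end Image

/-! ## §2 The regular class: `S_R(ker Q′_1)` and `S_1(ker Q′_1)` are mutually `ε`-close -/

section Regular

variable (n : ℕ) [NeZero n] (M : Fin d → ℕ) [hM : ∀ μ, NeZero (M μ)] [FiniteDimensional ℂ E]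


/-- the closeness constant of the regular class: `regEps d n a ℓ = √(24d·(na)² + 48d²·(n²a² + n²ℓ)²)`. [folklore] -/
def regEps (d n : ℕ) (a ℓ : ℝ) : ℝ := Real.sqrt (24 * d * ((n : ℝ) * a) ^ 2 + 48 * (d : ℝ) ^ 2 * ((n : ℝ) ^ 2 * a ^ 2 + (n : ℝ) ^ 2 * ℓ) ^ 2)

omit [NeZero n] in
/-- `0 ≤ regEps`. [folklore] -/
theorem regEps_nonneg (a ℓ : ℝ) : 0 ≤ regEps d n a ℓ := Real.sqrt_nonneg _

/-- **the relative bound in `ℓ²` form**: for `k ∈ ker Q′_1`, `‖toLp (Δk) − toLp (div_R D_R k)‖ ≤ regEps·‖toLp (Δk)‖`. [folklore] -/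
theorem relBound_toLp {R : Tor (fine n M) → Fin d → (E →L[ℂ] E)} (hU : ∀ x μ, R x μ ∈ unitary (E →L[ℂ] E)) {a ℓ : ℝ}
    (ha : ∀ x μ, ‖R x μ - 1‖ ≤ a) (hℓ : ∀ x μ, ‖R x μ - R (x - unitVec (fine n M) μ) μ‖ ≤ ℓ)
    (k : Tor (fine n M) → E) (hk : k ∈ (kerAvgFlat n M : Submodule ℂ (Tor (fine n M) → E))) :
    ‖((WithLp.linearEquiv 2 ℂ (Tor (fine n M) → E)).symm.toLinearMap ∘ₗ lapOp (fine n M) (fun (_ : Tor (fine n M)) (_ : Fin d) => (1 : E →L[ℂ] E))) k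
        - ((WithLp.linearEquiv 2 ℂ (Tor (fine n M) → E)).symm.toLinearMap ∘ₗ lapOp (fine n M) R) k‖
      ≤ regEps d n a ℓ * ‖((WithLp.linearEquiv 2 ℂ (Tor (fine n M) → E)).symm.toLinearMap ∘ₗ lapOp (fine n M) (fun (_ : Tor (fine n M)) (_ : Fin d) => (1 : E →L[ℂ] E))) k‖ := by
  have hk' : Qcv n M (fun _ => (1 : E →L[ℂ] E)) k = 0 := by
    have h := LinearMap.mem_ker.mp hk
    rwa [avgOp_apply] at h
  have h := relBound_of_regular n M hU ha hℓ hk'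
  have e : nsqv (fine n M) (lapOp (fine n M) (fun (_ : Tor (fine n M)) (_ : Fin d) => (1 : E →L[ℂ] E)) k - lapOp (fine n M) R k) = nsqv (fine n M) (negLapv (fine n M) R k - negLapv (fine n M) (fun (_ : Tor (fine n M)) (_ : Fin d) => (1 : E →L[ℂ] E)) k) := by
    unfold nsqv
    exact sum_congr rfl fun x _ => by rw [Pi.sub_apply, Pi.sub_apply, norm_sub_rev]; rfl
  rw [lapLp_apply, lapLp_apply, ← toLp_sub, norm_toLp_eq_sqrt, norm_toLp_eq_sqrt, regEps, ← Real.sqrt_mul' _ (nsqv_nonneg _ _), e]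
  exact Real.sqrt_le_sqrt h

/-- **ONE-SIDED CLOSENESS, FLAT → BACKGROUND**: every `y ∈ S_1(ker Q′_1)` satisfies `‖y − Π_{S_R(ker Q′_1)} y‖ ≤ regEps·‖y‖`. [folklore] -/
theorem oneSided_flat {R : Tor (fine n M) → Fin d → (E →L[ℂ] E)} (hU : ∀ x μ, R x μ ∈ unitary (E →L[ℂ] E)) {a ℓ : ℝ}
    (ha : ∀ x μ, ‖R x μ - 1‖ ≤ a) (hℓ : ∀ x μ, ‖R x μ - R (x - unitVec (fine n M) μ) μ‖ ≤ ℓ) :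
    ∀ y ∈ sliceSub (fine n M) (fun (_ : Tor (fine n M)) (_ : Fin d) => (1 : E →L[ℂ] E)) (kerAvgFlat n M),
      ‖y - (sliceSub (fine n M) R (kerAvgFlat n M)).starProjection y‖ ≤ regEps d n a ℓ * ‖y‖ := by
  rw [sliceSub_eq_map, sliceSub_eq_map]
  exact oneSided_of_relBound (𝕜 := ℂ) ((WithLp.linearEquiv 2 ℂ (Tor (fine n M) → E)).symm.toLinearMap ∘ₗ lapOp (fine n M) (fun (_ : Tor (fine n M)) (_ : Fin d) => (1 : E →L[ℂ] E)))
    ((WithLp.linearEquiv 2 ℂ (Tor (fine n M) → E)).symm.toLinearMap ∘ₗ lapOp (fine n M) R) (kerAvgFlat n M) (relBound_toLp n M hU ha hℓ)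

/-- **ONE-SIDED CLOSENESS, BACKGROUND → FLAT** (`regEps < 1`): every `y′ ∈ S_R(ker Q′_1)` satisfies `‖y′ − Π_{S_1(ker Q′_1)} y′‖ ≤ (regEps/(1 − regEps))·‖y′‖`. [folklore] -/
theorem oneSided_reg {R : Tor (fine n M) → Fin d → (E →L[ℂ] E)} (hU : ∀ x μ, R x μ ∈ unitary (E →L[ℂ] E)) {a ℓ : ℝ}
    (ha : ∀ x μ, ‖R x μ - 1‖ ≤ a) (hℓ : ∀ x μ, ‖R x μ - R (x - unitVec (fine n M) μ) μ‖ ≤ ℓ) (hε : regEps d n a ℓ < 1) :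
    ∀ y' ∈ sliceSub (fine n M) R (kerAvgFlat n M),
      ‖y' - (sliceSub (fine n M) (fun (_ : Tor (fine n M)) (_ : Fin d) => (1 : E →L[ℂ] E)) (kerAvgFlat n M)).starProjection y'‖ ≤ regEps d n a ℓ / (1 - regEps d n a ℓ) * ‖y'‖ := by
  rw [sliceSub_eq_map, sliceSub_eq_map]
  refine oneSided_of_relBound (𝕜 := ℂ) ((WithLp.linearEquiv 2 ℂ (Tor (fine n M) → E)).symm.toLinearMap ∘ₗ lapOp (fine n M) R)
    ((WithLp.linearEquiv 2 ℂ (Tor (fine n M) → E)).symm.toLinearMap ∘ₗ lapOp (fine n M) (fun (_ : Tor (fine n M)) (_ : Fin d) => (1 : E →L[ℂ] E))) (kerAvgFlat n M) fun k hk => ?_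
  exact relBound_symm (fun k => ((WithLp.linearEquiv 2 ℂ (Tor (fine n M) → E)).symm.toLinearMap ∘ₗ lapOp (fine n M) (fun (_ : Tor (fine n M)) (_ : Fin d) => (1 : E →L[ℂ] E))) k)
    (fun k => ((WithLp.linearEquiv 2 ℂ (Tor (fine n M) → E)).symm.toLinearMap ∘ₗ lapOp (fine n M) R) k) (regEps_nonneg (d := d) n a ℓ) hε
    (relBound_toLp n M hU ha hℓ k hk)

/-- **THE FLAT PROJECTED PART IS CONTROLLED BY THE BACKGROUND ONE**: `(1 − ε)·‖Π_{S_1} v‖ ≤ ‖Π_{S_R} v‖ + (ε/(1−ε))·‖v‖` for every `v` (`ε = regEps < 1`). [folklore] -/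
theorem norm_proj_flat_le {R : Tor (fine n M) → Fin d → (E →L[ℂ] E)} (hU : ∀ x μ, R x μ ∈ unitary (E →L[ℂ] E)) {a ℓ : ℝ}
    (ha : ∀ x μ, ‖R x μ - 1‖ ≤ a) (hℓ : ∀ x μ, ‖R x μ - R (x - unitVec (fine n M) μ) μ‖ ≤ ℓ) (hε : regEps d n a ℓ < 1)
    (v : PiLp 2 (fun _ : Tor (fine n M) => E)) :
    (1 - regEps d n a ℓ) * ‖(sliceSub (fine n M) (fun (_ : Tor (fine n M)) (_ : Fin d) => (1 : E →L[ℂ] E)) (kerAvgFlat n M)).starProjection v‖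
      ≤ ‖(sliceSub (fine n M) R (kerAvgFlat n M)).starProjection v‖ + regEps d n a ℓ / (1 - regEps d n a ℓ) * ‖v‖ :=
  norm_starProjection_le_of_oneSided _ _ (div_nonneg (regEps_nonneg (d := d) n a ℓ) (by linarith)) (oneSided_flat n M hU ha hℓ)
    (oneSided_reg n M hU ha hℓ hε) v

/-- **THE BACKGROUND COMPLEMENTARY PART IS CONTROLLED BY THE FLAT ONE**: `‖v − Π_{S_R} v‖ ≤ ‖v − Π_{S_1} v‖ + ε·‖Π_{S_1} v‖` for every `v` (`ε = regEps`). [folklore] -/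
theorem norm_orth_reg_le {R : Tor (fine n M) → Fin d → (E →L[ℂ] E)} (hU : ∀ x μ, R x μ ∈ unitary (E →L[ℂ] E)) {a ℓ : ℝ}
    (ha : ∀ x μ, ‖R x μ - 1‖ ≤ a) (hℓ : ∀ x μ, ‖R x μ - R (x - unitVec (fine n M) μ) μ‖ ≤ ℓ) (v : PiLp 2 (fun _ : Tor (fine n M) => E)) :
    ‖v - (sliceSub (fine n M) R (kerAvgFlat n M)).starProjection v‖
      ≤ ‖v - (sliceSub (fine n M) (fun (_ : Tor (fine n M)) (_ : Fin d) => (1 : E →L[ℂ] E)) (kerAvgFlat n M)).starProjection v‖ + regEps d n a ℓ * ‖(sliceSub (fine n M) (fun (_ : Tor (fine n M)) (_ : Fin d) => (1 : E →L[ℂ] E)) (kerAvgFlat n M)).starProjection v‖ :=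
  norm_sub_starProjection_le_of_oneSided _ _ (oneSided_flat n M hU ha hℓ) v

end Regular

end Summit.QuantumFields.BalabanUV.T4Continuum.SliceSubspaceRegular

end
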